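import Literature.Computability.AlgebraicComplexity.YoungSubgroupCharacterSum
import Literature.RepresentationTheory.FiniteGroups.IrreducibleCharacters
import Literature.RepresentationTheory.FiniteGroups.SymmetricGroupIsotypic
import Literature.RepresentationTheory.GeneralLinear.PlethysmWordModel
import HarnessLib

/-!
# Branching from `𝔖_n` to a product of subgroups of a Young subgroup (IK 2020, Prop. 10.1, part P2)

Topic `Literature/Computability/AlgebraicComplexity` (val-lit cell, board U1 = `IK2020_prop_10_1`;
the "P2 core" of `HOME/bip/NOTE-t08g3-IK2020Prop101-route.md`). Theorems only.

Ikenmeyer–Kandasamy 2020, proof of Prop. 10.1 (arXiv:1911.03990, §10, TeX L866–880): for a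
content vector `γ = D·ϱ` the stabiliser `K_γ ≤ 𝔖_{dD}` of a word of content `γ` up to relabelling
of the letters is `∏_{i ≥ 1} 𝔖_{ρ̂_i} ≀ 𝔖_{iD}`, a product of wreath products sitting inside the Young
subgroup `Y = ∏_i 𝔖_{n_i}`, `n_i = D · i · ρ̂_i`; and
`dim [λ]^{K_γ} = ∑_{μ•} c^λ_{μ¹…μ^d} ∏_i dim [μ^i]^{𝔖_{ρ̂_i} ≀ 𝔖_{iD}} = b(λ, ϱ, D, d)`
("`{λ}^ϱ ≃ [λ]^{G_ϱ}` [ike:12b, 4.3(A)] and Schur–Weyl duality"). This file proves the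
character-theoretic heart of that sentence for ARBITRARY subgroups `K_i ≤ 𝔖_{n_i}`:

* §1 conjugation averaging on a finite group and on a product of finite groups;
* §2 on one symmetric group the conjugation average of any function is its Fourier expansion in
  Specht characters (`IsClassFun.eq_sum_classInner_smul`, `irrChars_toFinset_perm_eq`);
* §3 `sum_prod_mul_eq_sum_prod_classInner_mul`: for a class function `F` on
  `Y = ∏_i 𝔖_{n_i}` and functions `φ_i` on the factors,
  `∑_y (∏_i φ_i(y_i)) F(y) = ∑_{μ•} (∏_i ⟨φ_i, χ^{μ^i}⟩) ∑_y (∏_i χ^{μ^i}(y_i)) F(y)` — so no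
  completeness statement for the product group is needed (for that route see p5's
  `PiGroupCharacters.lean`, `IsClassFun.eq_sum_classInner_prodSpecht`);
* §4 `card_inv_mul_sum_spechtCharacter_map_youngEmb_pi`: for subgroups `K_i ≤ 𝔖_{n_i}` and
  `K = ψ(∏_i K_i)`, `ψ` the Young embedding,
  `|K|⁻¹ ∑_{κ ∈ K} χ^λ(κ) = ∑_{μ•} c^λ_{μ•} ∏_i |K_i|⁻¹ ∑_{K_i} χ^{μ^i}` with `c^λ_{μ•}` IK's
  `multiLRCoeff` (t01's Frobenius form `IK2020.prod_factorial_mul_multiLRCoeff_eq_sum`);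
* §5 `finrank_invariants_hwPermRep_map_youngEmb_pi`: the same as `dim (HW_λ((ℂ^N)^{⊗n}))^K`
  (`card_inv_mul_sum_char_eq_finrank`, `character_hwPermRep`);
* §6 `finrank_invariants_hwPermRep_eq_bCoeff`, `exists_word_subgroup_finrank_eq_bCoeff`: with
  IK's block sizes `n_i = D(i+1)ρ̂_{i+1}` this is `b(λ,ϱ,D,d)` (`IK2020.bCoeff`), GIVEN the word
  side (block averages of the wreath products = plethysm coefficients, vanishing of `c^λ_{μ•}`
  for `ℓ(μ^i) > m`, and a block word whose stabiliser up to relabelling is `ψ(∏ K_i)`) — the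
  output is exactly the hypothesis of t01's `IK2020_prop_10_1_of_finrank_invariants_eq_bCoeff`,
  the `∑ n_i = dD` bookkeeping being a `subst`.

Honest framing: finite-group character bookkeeping of a printed proof; VP ≠ VNP is NOT proved and
nothing here bears on it.

## References

* [IkenmeyerKandasamy2019] C. Ikenmeyer, U. Kandasamy, arXiv:1911.03990, §10 (proof of
  Prop. 10.1).
* [FultonHarrisGTM129] W. Fulton, J. Harris, *Representation Theory*, GTM 129: §2.2 (2.9), §2.5,
  §4.3 (4.41)–(4.43), Ex. 4.44.
* [SerreLinearRepresentations1977] J.-P. Serre, *Linear Representations of Finite Groups*, §2.5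
  Thm. 6, §3.2 Thm. 10.
-/

noncomputable section

open scoped BigOperators

namespace Literature.Computability.AlgebraicComplexity

open _root_.Literature.NumberTheory.DiophantineGeometry
open _root_.Literature.RepresentationTheory.FiniteGroups

namespace YoungBranching

/-! ### §1 Conjugation averaging -/

section ConjAvg

variable {H : Type} [Group H] [Fintype H]

/-- Re-indexing a sum along conjugation by `h` (Fulton–Harris §2.2). [cite: FultonHarrisGTM129, §2.2 (2.9)] -/
theorem sum_conj_eq (f : H → ℂ) (h : H) : ∑ y, f (h * y * h⁻¹) = ∑ y, f y :=
  Fintype.sum_equiv (MulAut.conj h).toEquiv _ _ fun _ => rfl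

/-- **Averaging against a class function**: `∑_y Ψ(y) F(y) = ∑_y Ψ^avg(y) F(y)` with
`Ψ^avg(y) = |H|⁻¹ ∑_h Ψ(h y h⁻¹)`, for `F` a class function (Fulton–Harris §2.2: class functions
are the centre of the convolution algebra). [cite: FultonHarrisGTM129, §2.2 (2.9)] -/
theorem sum_mul_eq_sum_conjAvg_mul (Ψ F : H → ℂ) (hF : IsClassFun F) :
    ∑ y, Ψ y * F y = ∑ y, ((Fintype.card H : ℂ)⁻¹ * ∑ h, Ψ (h * y * h⁻¹)) * F y := by
  have hcard : (Fintype.card H : ℂ) ≠ 0 := Nat.cast_ne_zero.mpr Fintype.card_ne_zero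
  have key : ∀ h : H, ∑ y, Ψ (h * y * h⁻¹) * F y = ∑ y, Ψ y * F y := by
    intro h
    calc ∑ y, Ψ (h * y * h⁻¹) * F y = ∑ y, Ψ (h * y * h⁻¹) * F (h * y * h⁻¹) := by
          refine Finset.sum_congr rfl fun y _ => ?_
          rw [hF y h]
      _ = ∑ y, Ψ y * F y := sum_conj_eq (fun y => Ψ y * F y) h
  calc ∑ y, Ψ y * F y
      = (Fintype.card H : ℂ)⁻¹ * ∑ h : H, ∑ y, Ψ (h * y * h⁻¹) * F y := by
        rw [Finset.sum_congr rfl fun h (_ : h ∈ Finset.univ) => key h, Finset.sum_const,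
          Finset.card_univ, nsmul_eq_mul, ← mul_assoc, inv_mul_cancel₀ hcard, one_mul]
    _ = ∑ y, ((Fintype.card H : ℂ)⁻¹ * ∑ h, Ψ (h * y * h⁻¹)) * F y := by
        rw [Finset.sum_comm, Finset.mul_sum]
        refine Finset.sum_congr rfl fun y _ => ?_
        rw [Finset.mul_sum, Finset.mul_sum, Finset.sum_mul]
        refine Finset.sum_congr rfl fun h _ => ?_
        ring

/-- The conjugation average of any function is a class function (Fulton–Harris §2.2).
[cite: FultonHarrisGTM129, §2.2 (2.9)] -/
theorem isClassFun_conjAvg (Ψ : H → ℂ) :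
    IsClassFun fun y => (Fintype.card H : ℂ)⁻¹ * ∑ h, Ψ (h * y * h⁻¹) := by
  intro s t
  simp only
  congr 1
  calc ∑ h, Ψ (h * (t * s * t⁻¹) * h⁻¹) = ∑ h, Ψ ((h * t) * s * (h * t)⁻¹) := by
        refine Finset.sum_congr rfl fun h _ => ?_
        rw [mul_inv_rev]
        group
    _ = ∑ h, Ψ (h * s * h⁻¹) :=
        Fintype.sum_equiv (Equiv.mulRight t) _ _ fun _ => rfl

/-- Averaging does not change inner products with class functions:
`⟨Ψ^avg, F⟩ = ⟨Ψ, F⟩` (Fulton–Harris §2.2). [cite: FultonHarrisGTM129, §2.2 (2.9)] -/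
theorem classInner_conjAvg (Ψ F : H → ℂ) (hF : IsClassFun F) :
    classInner (fun y => (Fintype.card H : ℂ)⁻¹ * ∑ h, Ψ (h * y * h⁻¹)) F = classInner Ψ F := by
  rw [classInner_apply, classInner_apply]
  congr 1
  have hF' : IsClassFun fun s : H => F s⁻¹ := by
    intro s t
    simp only
    rw [mul_inv_rev, mul_inv_rev, inv_inv, ← mul_assoc, hF]
  exact (sum_mul_eq_sum_conjAvg_mul Ψ (fun s => F s⁻¹) hF').symm

end ConjAvg

section PiAvg

variable {ι : Type} [Fintype ι] [DecidableEq ι] {G : ι → Type} [∀ i, Group (G i)]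
  [∀ i, Fintype (G i)]

/-- **The conjugation average of a product function on a product group is the product of the
averages** (Fubini; Serre §3.2, characters of a product). [cite: SerreLinearRepresentations1977, §3.2 Thm. 10] -/
theorem conjAvg_pi (φ : ∀ i, G i → ℂ) (y : ∀ i, G i) :
    (Fintype.card (∀ i, G i) : ℂ)⁻¹ * ∑ h : (∀ i, G i), ∏ i, φ i ((h * y * h⁻¹) i) =
      ∏ i, ((Fintype.card (G i) : ℂ)⁻¹ * ∑ g : G i, φ i (g * y i * g⁻¹)) := by
  simp only [Pi.mul_apply, Pi.inv_apply]
  rw [Finset.prod_mul_distrib, Finset.prod_inv_distrib, ← Nat.cast_prod, ← Fintype.card_pi,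
    Finset.prod_univ_sum, Fintype.piFinset_univ]

end PiAvg

/-! ### §2 One symmetric group: the average is the Specht expansion -/

section Specht

variable {n : ℕ}

/-- On `𝔖_n` (over `ℂ`) every class function is its Fourier expansion in Specht characters:
`f = ∑_{μ ⊢ n} ⟨f, χ^μ⟩ χ^μ` (Serre §2.5 Thm. 6 with the classification of the irreducible
characters of `𝔖_n`, tree `irrChars_toFinset_perm_eq`). [cite: SerreLinearRepresentations1977, §2.5 Thm. 6] -/
theorem eq_sum_specht_of_isClassFun {f : Equiv.Perm (Fin n) → ℂ} (hf : IsClassFun f) :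
    f = ∑ μ : Nat.Partition n, classInner f (spechtCharacter ℂ μ) • spechtCharacter ℂ μ := by
  classical
  conv_lhs => rw [hf.eq_sum_classInner_smul, irrChars_toFinset_perm_eq]
  rw [Finset.sum_image fun μ _ ν _ h => spechtCharacter_injective h]

/-- Pointwise form of `eq_sum_specht_of_isClassFun`. [cite: SerreLinearRepresentations1977, §2.5 Thm. 6] -/
theorem apply_eq_sum_specht_of_isClassFun {f : Equiv.Perm (Fin n) → ℂ} (hf : IsClassFun f)
    (g : Equiv.Perm (Fin n)) :
    f g = ∑ μ : Nat.Partition n, classInner f (spechtCharacter ℂ μ) * spechtCharacter ℂ μ g := by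
  conv_lhs => rw [eq_sum_specht_of_isClassFun hf]
  simp [Finset.sum_apply]

/-- **The conjugation average of any function on `𝔖_n` is its Specht expansion**:
`|𝔖_n|⁻¹ ∑_h φ(h g h⁻¹) = ∑_{μ ⊢ n} ⟨φ, χ^μ⟩ χ^μ(g)`. [cite: SerreLinearRepresentations1977, §2.5 Thm. 6] -/
theorem conjAvg_eq_sum_specht (φ : Equiv.Perm (Fin n) → ℂ) (g : Equiv.Perm (Fin n)) :
    (Fintype.card (Equiv.Perm (Fin n)) : ℂ)⁻¹ * ∑ h, φ (h * g * h⁻¹) =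
      ∑ μ : Nat.Partition n, classInner φ (spechtCharacter ℂ μ) * spechtCharacter ℂ μ g := by
  rw [apply_eq_sum_specht_of_isClassFun (isClassFun_conjAvg φ) g]
  refine Finset.sum_congr rfl fun μ _ => ?_
  rw [classInner_conjAvg φ _ (isIrrChar_spechtCharacter μ).isCharacter.isClassFun]

/-- The inner product with a Specht character, without inverses (`χ^μ(s⁻¹) = χ^μ(s)`, the
Specht characters being real): `⟨φ, χ^μ⟩ = (n!)⁻¹ ∑_s φ(s) χ^μ(s)` (Fulton–Harris §2.2 (2.11)
with Ex. 4.4). [cite: FultonHarrisGTM129, §2.2 (2.9)] -/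
theorem classInner_spechtCharacter (φ : Equiv.Perm (Fin n) → ℂ) (μ : Nat.Partition n) :
    classInner φ (spechtCharacter ℂ μ) =
      (n.factorial : ℂ)⁻¹ * ∑ s, φ s * spechtCharacter ℂ μ s := by
  rw [classInner_apply, Fintype.card_perm, Fintype.card_fin]
  congr 1
  refine Finset.sum_congr rfl fun s _ => ?_
  rw [_root_.Literature.RepresentationTheory.FiniteGroups.spechtCharacter_inv]

end Specht

/-! ### §3 Product functions against class functions on `∏_i 𝔖_{n_i}` -/

section PiSpecht

variable {ι : Type} [Fintype ι] [DecidableEq ι] (n : ι → ℕ)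

/-- **Expansion of a product function against a class function of `Y = ∏_i 𝔖_{n_i}`**:
`∑_y (∏_i φ_i(y_i)) F(y) = ∑_{μ•} (∏_i ⟨φ_i, χ^{μ^i}⟩) · ∑_y (∏_i χ^{μ^i}(y_i)) F(y)` for every
class function `F` on `Y` — the product function is replaced by its conjugation average (§1),
which factorises blockwise into Specht expansions (§2). No completeness statement for the
product group is needed. [cite: SerreLinearRepresentations1977, §2.5 Thm. 6 and §3.2 Thm. 10] -/
theorem sum_prod_mul_eq_sum_prod_classInner_mul (φ : ∀ i, Equiv.Perm (Fin (n i)) → ℂ)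
    (F : (∀ i, Equiv.Perm (Fin (n i))) → ℂ) (hF : IsClassFun F) :
    ∑ y : (∀ i, Equiv.Perm (Fin (n i))), (∏ i, φ i (y i)) * F y =
      ∑ μ : (∀ i, Nat.Partition (n i)),
        (∏ i, classInner (φ i) (spechtCharacter ℂ (μ i))) *
          ∑ y : (∀ i, Equiv.Perm (Fin (n i))), (∏ i, spechtCharacter ℂ (μ i) (y i)) * F y := by
  rw [sum_mul_eq_sum_conjAvg_mul _ F hF]
  have havg : ∀ y : (∀ i, Equiv.Perm (Fin (n i))),
      (Fintype.card (∀ i, Equiv.Perm (Fin (n i))) : ℂ)⁻¹ *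
          ∑ h : (∀ i, Equiv.Perm (Fin (n i))), ∏ i, φ i ((h * y * h⁻¹) i) =
        ∑ μ : (∀ i, Nat.Partition (n i)),
          ∏ i, classInner (φ i) (spechtCharacter ℂ (μ i)) * spechtCharacter ℂ (μ i) (y i) := by
    intro y
    rw [conjAvg_pi]
    simp_rw [conjAvg_eq_sum_specht]
    rw [Finset.prod_univ_sum, Fintype.piFinset_univ]
  simp_rw [havg, Finset.sum_mul, Finset.prod_mul_distrib]
  rw [Finset.sum_comm]
  refine Finset.sum_congr rfl fun μ _ => ?_
  rw [Finset.mul_sum]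
  refine Finset.sum_congr rfl fun y _ => ?_
  ring

/-- The case of indicator functions: summing a class function over a product of subsets.
`∑_{y ∈ ∏ K_i} F(y) = ∑_{μ•} (∏_i (n_i!)⁻¹ ∑_{s ∈ K_i} χ^{μ^i}(s)) · ∑_y (∏_i χ^{μ^i}(y_i)) F(y)`.
[cite: FultonHarrisGTM129, §2.2 (2.9)] -/
theorem sum_piFinset_eq_sum_prod_mul (K : ∀ i, Finset (Equiv.Perm (Fin (n i))))
    (F : (∀ i, Equiv.Perm (Fin (n i))) → ℂ) (hF : IsClassFun F) :
    ∑ y ∈ Fintype.piFinset K, F y =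
      ∑ μ : (∀ i, Nat.Partition (n i)),
        (∏ i, (((n i).factorial : ℂ)⁻¹ * ∑ s ∈ K i, spechtCharacter ℂ (μ i) s)) *
          ∑ y : (∀ i, Equiv.Perm (Fin (n i))), (∏ i, spechtCharacter ℂ (μ i) (y i)) * F y := by
  classical
  have h := sum_prod_mul_eq_sum_prod_classInner_mul n
    (fun i s => if s ∈ K i then (1 : ℂ) else 0) F hF
  have hL : ∑ y : (∀ i, Equiv.Perm (Fin (n i))), (∏ i, if y i ∈ K i then (1 : ℂ) else 0) * F y =
      ∑ y ∈ Fintype.piFinset K, F y := by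
    rw [← Finset.sum_filter_add_sum_filter_not Finset.univ (fun y => y ∈ Fintype.piFinset K)]
    have h1 : ∑ y ∈ Finset.univ.filter (fun y => y ∈ Fintype.piFinset K),
        (∏ i, if y i ∈ K i then (1 : ℂ) else 0) * F y = ∑ y ∈ Fintype.piFinset K, F y := by
      rw [Finset.filter_mem_eq_inter, Finset.univ_inter]
      refine Finset.sum_congr rfl fun y hy => ?_
      rw [Finset.prod_eq_one fun i _ => if_pos (Fintype.mem_piFinset.mp hy i), one_mul]
    have h2 : ∑ y ∈ Finset.univ.filter (fun y => ¬ y ∈ Fintype.piFinset K),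
        (∏ i, if y i ∈ K i then (1 : ℂ) else 0) * F y = 0 := by
      refine Finset.sum_eq_zero fun y hy => ?_
      obtain ⟨i, hi⟩ : ∃ i, y i ∉ K i := by
        simpa [Fintype.mem_piFinset] using (Finset.mem_filter.mp hy).2
      rw [Finset.prod_eq_zero (Finset.mem_univ i) (if_neg hi), zero_mul]
    rw [h1, h2, add_zero]
  rw [← hL, h]
  refine Finset.sum_congr rfl fun μ _ => ?_
  congr 1
  refine Finset.prod_congr rfl fun i _ => ?_
  rw [classInner_spechtCharacter]
  congr 1
  simp only [ite_mul, one_mul, zero_mul, Finset.sum_ite_mem, Finset.univ_inter]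

end PiSpecht

/-! ### §4 Branching to a product of subgroups of the Young subgroup -/

section Branching

variable {d : ℕ} {n : Fin d → ℕ}

/-- The product of the injections of the coordinates is the element, `∏_i ι_i(y_i) = y` (list
product; Mathlib's `Finset.noncommProd_mulSingle`). [folklore] -/
private theorem prod_ofFn_mulSingle {H : Fin d → Type*} [∀ i, Group (H i)] (y : (i : Fin d) → H i) :
    (List.ofFn fun i => Pi.mulSingle i (y i)).prod = y := by
  classical
  have h1 : (List.ofFn fun i => Pi.mulSingle (M := H) i (y i)).prod =
      (List.finRange d).toFinset.noncommProd (fun i => Pi.mulSingle (M := H) i (y i))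
        (fun i _ j _ _ => Pi.mulSingle_apply_commute y i j) := by
    rw [Finset.noncommProd_toFinset _ _ _ (List.nodup_finRange d), List.ofFn_eq_map]
  rw [h1]
  have h2 := Finset.noncommProd_mulSingle (M := H) y
  convert h2 using 2
  exact List.toFinset_finRange d

/-- The product of the block permutations `y₁ ⋯ y_d` (`IK2020.blockPermHom`) is the image of `y`
under the Young embedding `∏_i 𝔖_{n_i} → 𝔖_n` (the `finSigmaFinEquiv`-conjugate of
`Equiv.Perm.sigmaCongrRightHom`; Fulton–Harris §4.3, the Young subgroup before (4.41)).
[cite: FultonHarrisGTM129, §4.3 (4.41)] -/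
theorem prod_ofFn_blockPermHom_eq (y : (i : Fin d) → Equiv.Perm (Fin (n i))) :
    (List.ofFn fun i => IK2020.blockPermHom n i (y i)).prod =
      ((Equiv.permCongrHom (finSigmaFinEquiv (n := n))).toMonoidHom.comp
        (Equiv.Perm.sigmaCongrRightHom fun j => Fin (n j))) y := by
  classical
  have h : (fun i => IK2020.blockPermHom n i (y i)) =
      ⇑((Equiv.permCongrHom (finSigmaFinEquiv (n := n))).toMonoidHom.comp
        (Equiv.Perm.sigmaCongrRightHom fun j => Fin (n j))) ∘ fun i => Pi.mulSingle i (y i) := by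
    funext i
    rw [Function.comp_apply, IK2020.blockPermHom, MonoidHom.comp_apply, MonoidHom.mulSingle_apply]
  rw [h, ← List.map_ofFn, ← map_list_prod, prod_ofFn_mulSingle]

/-- The Young embedding `∏_i 𝔖_{n_i} → 𝔖_n` is injective (Fulton–Harris §4.3: the Young
subgroup is a direct product). [cite: FultonHarrisGTM129, §4.3 (4.41)] -/
theorem youngEmb_injective :
    Function.Injective ((Equiv.permCongrHom (finSigmaFinEquiv (n := n))).toMonoidHom.comp
        (Equiv.Perm.sigmaCongrRightHom fun j => Fin (n j))) :=
  (Equiv.permCongrHom (finSigmaFinEquiv (n := n))).injective.comp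
    Equiv.Perm.sigmaCongrRightHom_injective

/-- A class function of `𝔖_n` pulled back along the Young embedding is a class function of
`∏_i 𝔖_{n_i}`; in particular `y ↦ χ^λ(y₁ ⋯ y_d)` (the restricted character `Res χ^λ`,
Fulton–Harris §4.3 (4.42)). [cite: FultonHarrisGTM129, §4.3 (4.42)] -/
theorem isClassFun_spechtCharacter_comp_youngEmb (lam : Nat.Partition (∑ j, n j)) :
    IsClassFun fun y : (i : Fin d) → Equiv.Perm (Fin (n i)) =>
      spechtCharacter ℂ lam (((Equiv.permCongrHom (finSigmaFinEquiv (n := n))).toMonoidHom.comp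
        (Equiv.Perm.sigmaCongrRightHom fun j => Fin (n j))) y) := by
  intro s t
  simp only [map_mul, map_inv]
  exact (isIrrChar_spechtCharacter lam).isCharacter.isClassFun _ _

/-- t01's Frobenius form `(∏_i n_i!) · c^λ_{μ•} = ∑_y (∏_i χ^{μ^i}(y_i)) χ^λ(y₁ ⋯ y_d)`
(`IK2020.prod_factorial_mul_multiLRCoeff_eq_sum`) with the Young embedding written as the
`finSigmaFinEquiv`-conjugate of `sigmaCongrRightHom`. [cite: FultonHarrisGTM129, §4.3 (4.41)–(4.43)] -/
theorem sum_prod_spechtCharacter_mul_spechtCharacter_youngEmb {N : ℕ}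
    (μ : (i : Fin d) → Nat.Partition (n i)) (lam : Nat.Partition (∑ j, n j))
    (hlam : lam.parts.card ≤ N) :
    ∑ y : ((i : Fin d) → Equiv.Perm (Fin (n i))),
        (∏ i, spechtCharacter ℂ (μ i) (y i)) *
          spechtCharacter ℂ lam (((Equiv.permCongrHom (finSigmaFinEquiv (n := n))).toMonoidHom.comp
            (Equiv.Perm.sigmaCongrRightHom fun j => Fin (n j))) y) =
      (∏ i, ((n i).factorial : ℂ)) * (IK2020.multiLRCoeff ℂ N μ lam : ℂ) := by
  rw [IK2020.prod_factorial_mul_multiLRCoeff_eq_sum ℂ μ lam hlam]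
  simp_rw [prod_ofFn_blockPermHom_eq]

/-- **Summing `χ^λ` over a product of subsets of the blocks**: for finite sets `K_i ⊆ 𝔖_{n_i}` and
`ℓ(λ) ≤ N`,
`∑_{y ∈ ∏ K_i} χ^λ(y₁ ⋯ y_d) = ∑_{μ•} c^λ_{μ¹…μ^d} · ∏_i ∑_{s ∈ K_i} χ^{μ^i}(s)`
(`c^λ_{μ•}` = IK's `multiLRCoeff`): §3 and the Frobenius form of `c^λ_{μ•}`; the factorials
cancel. [cite: IkenmeyerKandasamy2019, §10 (proof of Prop. 10.1)] -/
theorem sum_piFinset_spechtCharacter_youngEmb {N : ℕ}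
    (K : (i : Fin d) → Finset (Equiv.Perm (Fin (n i)))) (lam : Nat.Partition (∑ j, n j))
    (hlam : lam.parts.card ≤ N) :
    ∑ y ∈ Fintype.piFinset K,
        spechtCharacter ℂ lam (((Equiv.permCongrHom (finSigmaFinEquiv (n := n))).toMonoidHom.comp
          (Equiv.Perm.sigmaCongrRightHom fun j => Fin (n j))) y) =
      ∑ μ : ((i : Fin d) → Nat.Partition (n i)),
        (IK2020.multiLRCoeff ℂ N μ lam : ℂ) * ∏ i, ∑ s ∈ K i, spechtCharacter ℂ (μ i) s := by
  rw [sum_piFinset_eq_sum_prod_mul n K _ (isClassFun_spechtCharacter_comp_youngEmb lam)]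
  refine Finset.sum_congr rfl fun μ _ => ?_
  rw [sum_prod_spechtCharacter_mul_spechtCharacter_youngEmb μ lam hlam, Finset.prod_mul_distrib,
    Finset.prod_inv_distrib]
  have hf : (∏ i, ((n i).factorial : ℂ)) ≠ 0 :=
    Finset.prod_ne_zero_iff.mpr fun i _ => Nat.cast_ne_zero.mpr (Nat.factorial_ne_zero _)
  field_simp

/-- Membership in the image of a product of subgroups under the Young embedding (unfolding
lemma; the subgroup `∏ K_i ≤ ∏ 𝔖_{n_i} ≤ 𝔖_n` of IK §10). [cite: IkenmeyerKandasamy2019, §10 (proof of Prop. 10.1)] -/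
theorem mem_map_youngEmb_pi_iff (K : (i : Fin d) → Subgroup (Equiv.Perm (Fin (n i))))
    (τ : Equiv.Perm (Fin (∑ j, n j))) :
    τ ∈ (Subgroup.pi Set.univ K).map
        ((Equiv.permCongrHom (finSigmaFinEquiv (n := n))).toMonoidHom.comp
          (Equiv.Perm.sigmaCongrRightHom fun j => Fin (n j))) ↔
      ∃ y : (i : Fin d) → Equiv.Perm (Fin (n i)), (∀ i, y i ∈ K i) ∧
        ((Equiv.permCongrHom (finSigmaFinEquiv (n := n))).toMonoidHom.comp
          (Equiv.Perm.sigmaCongrRightHom fun j => Fin (n j))) y = τ := by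
  rw [Subgroup.mem_map]
  constructor
  · rintro ⟨y, hy, rfl⟩
    exact ⟨y, fun i => (Subgroup.mem_pi Set.univ).mp hy i (Set.mem_univ i), rfl⟩
  · rintro ⟨y, hy, rfl⟩
    exact ⟨y, (Subgroup.mem_pi Set.univ).mpr fun i _ => hy i, rfl⟩

open scoped Classical in
/-- Summing a function over the image `ψ(∏_i K_i)` of a product of subgroups under the Young
embedding is summing over `∏_i K_i` (the subgroup of IK §10). [cite: IkenmeyerKandasamy2019, §10 (proof of Prop. 10.1)] -/
theorem sum_map_youngEmb_pi_eq (K : (i : Fin d) → Subgroup (Equiv.Perm (Fin (n i))))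
    (f : Equiv.Perm (Fin (∑ j, n j)) → ℂ) :
    ∑ κ : ↥((Subgroup.pi Set.univ K).map
        ((Equiv.permCongrHom (finSigmaFinEquiv (n := n))).toMonoidHom.comp
          (Equiv.Perm.sigmaCongrRightHom fun j => Fin (n j)))), f κ =
      ∑ y ∈ Fintype.piFinset fun i => Finset.univ.filter (· ∈ K i),
        f (((Equiv.permCongrHom (finSigmaFinEquiv (n := n))).toMonoidHom.comp
          (Equiv.Perm.sigmaCongrRightHom fun j => Fin (n j))) y) := by
  set ψ := (Equiv.permCongrHom (finSigmaFinEquiv (n := n))).toMonoidHom.comp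
    (Equiv.Perm.sigmaCongrRightHom fun j => Fin (n j)) with hψ
  have h1 : ∑ κ : ↥((Subgroup.pi Set.univ K).map ψ), f κ =
      ∑ y : ↥(Subgroup.pi Set.univ K), f (ψ (y : (i : Fin d) → Equiv.Perm (Fin (n i)))) := by
    refine (Fintype.sum_equiv
      (Subgroup.equivMapOfInjective (Subgroup.pi Set.univ K) ψ youngEmb_injective).toEquiv
      (fun y => f (ψ (y : (i : Fin d) → Equiv.Perm (Fin (n i)))))
      (fun κ => f (κ : Equiv.Perm (Fin (∑ j, n j)))) fun y => ?_).symm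
    simp only [MulEquiv.toEquiv_eq_coe, MulEquiv.coe_toEquiv]
    rw [Subgroup.coe_equivMapOfInjective_apply]
  rw [h1, Finset.sum_subtype (Fintype.piFinset fun i => Finset.univ.filter (· ∈ K i))
    (p := fun y => y ∈ Subgroup.pi Set.univ K)]
  intro y
  rw [Fintype.mem_piFinset, Subgroup.mem_pi]
  simp

/-- The order of `ψ(∏_i K_i)` is `∏_i |K_i|` (the subgroup of IK §10). [cite: IkenmeyerKandasamy2019, §10 (proof of Prop. 10.1)] -/
theorem natCard_map_youngEmb_pi (K : (i : Fin d) → Subgroup (Equiv.Perm (Fin (n i)))) :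
    (Nat.card ↥((Subgroup.pi Set.univ K).map
        ((Equiv.permCongrHom (finSigmaFinEquiv (n := n))).toMonoidHom.comp
          (Equiv.Perm.sigmaCongrRightHom fun j => Fin (n j)))) : ℂ) =
      ∏ i, (Nat.card ↥(K i) : ℂ) := by
  classical
  have h := sum_map_youngEmb_pi_eq K (fun _ => (1 : ℂ))
  simp only [Finset.sum_const, Finset.card_univ, nsmul_eq_mul, mul_one,
    Fintype.card_piFinset, Nat.cast_prod] at h
  rw [Nat.card_eq_fintype_card, h]
  refine Finset.prod_congr rfl fun i _ => ?_
  rw [Nat.card_eq_fintype_card, Fintype.card_subtype]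

open scoped Classical in
/-- **Branching rule to a product of subgroups of the Young subgroup** (character form): for
subgroups `K_i ≤ 𝔖_{n_i}`, `K = ψ(∏_i K_i) ≤ 𝔖_n` their product under the Young embedding and
`ℓ(λ) ≤ N`,
`|K|⁻¹ ∑_{κ ∈ K} χ^λ(κ) = ∑_{μ•} c^λ_{μ¹…μ^d} ∏_i |K_i|⁻¹ ∑_{s ∈ K_i} χ^{μ^i}(s)`,
i.e. `dim [λ]^K = ∑_{μ•} c^λ_{μ•} ∏_i dim [μ^i]^{K_i}` (Ikenmeyer–Kandasamy's
"`dim [λ]^{G_ϱ} = ∑ c^λ_{μ•} ∏ a_{μ^i}`" step in the proof of Prop. 10.1, for arbitrary `K_i`).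
[cite: IkenmeyerKandasamy2019, §10 (proof of Prop. 10.1)] [cite: FultonHarrisGTM129, §2.2 (2.9)] -/
theorem card_inv_mul_sum_spechtCharacter_map_youngEmb_pi {N : ℕ}
    (K : (i : Fin d) → Subgroup (Equiv.Perm (Fin (n i)))) (lam : Nat.Partition (∑ j, n j))
    (hlam : lam.parts.card ≤ N) :
    (Nat.card ↥((Subgroup.pi Set.univ K).map
        ((Equiv.permCongrHom (finSigmaFinEquiv (n := n))).toMonoidHom.comp
          (Equiv.Perm.sigmaCongrRightHom fun j => Fin (n j)))) : ℂ)⁻¹ *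
      ∑ κ : ↥((Subgroup.pi Set.univ K).map
        ((Equiv.permCongrHom (finSigmaFinEquiv (n := n))).toMonoidHom.comp
          (Equiv.Perm.sigmaCongrRightHom fun j => Fin (n j)))),
        spechtCharacter ℂ lam (κ : Equiv.Perm (Fin (∑ j, n j))) =
      ∑ μ : ((i : Fin d) → Nat.Partition (n i)),
        (IK2020.multiLRCoeff ℂ N μ lam : ℂ) *
          ∏ i, ((Nat.card ↥(K i) : ℂ)⁻¹ *
            ∑ s : ↥(K i), spechtCharacter ℂ (μ i) (s : Equiv.Perm (Fin (n i)))) := by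
  rw [natCard_map_youngEmb_pi, sum_map_youngEmb_pi_eq K (spechtCharacter ℂ lam),
    sum_piFinset_spechtCharacter_youngEmb _ lam hlam, Finset.mul_sum]
  refine Finset.sum_congr rfl fun μ _ => ?_
  rw [Finset.prod_mul_distrib, Finset.prod_inv_distrib, mul_left_comm]
  congr 2
  refine Finset.prod_congr rfl fun i _ => ?_
  exact Finset.sum_subtype _ (fun s => by simp) _

end Branching

/-! ### §5 The invariant-dimension form: `dim [λ]^K` on `HW_λ((ℂ^N)^{⊗n})` -/

section Invariants

variable {d : ℕ} {n : Fin d → ℕ}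

open scoped Classical in
/-- **`dim (HW_λ)^K = ∑_{μ•} c^λ_{μ•} ∏_i |K_i|⁻¹ ∑_{K_i} χ^{μ^i}`** for `K = ψ(∏_i K_i)` the image of
a product of subgroups of the blocks under the Young embedding: the `K`-invariants of the Specht
module `[λ]`, realised as the highest-weight vectors of weight `λ` in the word model of
`(ℂ^N)^{⊗n}` (`hwPermRep`, `character_hwPermRep`; `ℓ(λ) ≤ N`), have dimension
`|K|⁻¹ ∑_K χ^λ` (Fulton–Harris (2.9)), which §4 expands. [cite: IkenmeyerKandasamy2019, §10 (proof of Prop. 10.1)]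
[cite: FultonHarrisGTM129, §2.2 (2.9) and Thm. 6.3 (2)] -/
theorem finrank_invariants_hwPermRep_map_youngEmb_pi {N : ℕ}
    (K : (i : Fin d) → Subgroup (Equiv.Perm (Fin (n i)))) (lam : Nat.Partition (∑ j, n j))
    (hlam : lam.parts.card ≤ N) :
    (Module.finrank ℂ (Representation.invariants
        ((hwPermRep ℂ (D := ∑ j, n j) (Weight.ofPartition N lam)).comp
          ((Subgroup.pi Set.univ K).map
            ((Equiv.permCongrHom (finSigmaFinEquiv (n := n))).toMonoidHom.comp
              (Equiv.Perm.sigmaCongrRightHom fun j => Fin (n j)))).subtype)) : ℂ) =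
      ∑ μ : ((i : Fin d) → Nat.Partition (n i)),
        (IK2020.multiLRCoeff ℂ N μ lam : ℂ) *
          ∏ i, ((Nat.card ↥(K i) : ℂ)⁻¹ *
            ∑ s : ↥(K i), spechtCharacter ℂ (μ i) (s : Equiv.Perm (Fin (n i)))) := by
  set Kt := (Subgroup.pi Set.univ K).map
    ((Equiv.permCongrHom (finSigmaFinEquiv (n := n))).toMonoidHom.comp
      (Equiv.Perm.sigmaCongrRightHom fun j => Fin (n j))) with hKt
  rw [← card_inv_mul_sum_spechtCharacter_map_youngEmb_pi K lam hlam]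
  have hcard : (Nat.card ↥Kt : ℂ) ≠ 0 := Nat.cast_ne_zero.mpr Nat.card_pos.ne'
  haveI : Invertible (Nat.card ↥Kt : ℂ) := invertibleOfNonzero hcard
  have hinv := Representation.card_inv_mul_sum_char_eq_finrank
    ((hwPermRep ℂ (D := ∑ j, n j) (Weight.ofPartition N lam)).comp Kt.subtype)
  have hchar : ∀ κ : ↥Kt, Representation.character
      ((hwPermRep ℂ (D := ∑ j, n j) (Weight.ofPartition N lam)).comp Kt.subtype) κ =
      spechtCharacter ℂ lam (κ : Equiv.Perm (Fin (∑ j, n j))) := by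
    intro κ
    rw [← character_hwPermRep ℂ lam hlam]
    rfl
  simp only [hchar] at hinv
  rw [← hinv]

end Invariants

/-! ### §6 Ikenmeyer–Kandasamy's blocks: `dim [λ]^{K_γ} = b(λ, ϱ, D, d)` modulo the word side -/

section IKBlocks

open IK2020

open scoped Classical in
/-- **`dim (HW_λ)^K = b(λ, ϱ, D, d)`** for `K = ψ(∏_i K_i)` with IK's block sizes
`n_i = D · (i+1) · ρ̂_{i+1}` (`i : Fin d`, the index set and order of `IK2020.bCoeff`), PROVIDED the
block averages are the plethysm coefficients `a_{μ^i}(ρ̂_{i+1}, (i+1)D)` for `ℓ(μ^i) ≤ m` (the word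
side: `K_i = 𝔖_{ρ̂_{i+1}} ≀ 𝔖_{(i+1)D}`, `card_mul_finrank_wreathHW`) and the multi-Littlewood–Richardson
coefficients vanish when some `μ^i` has more than `m` parts (`{μ^i} = 0` for `GL_m`). This is the
sentence "`dim [λ]^{G_ϱ} = ∑_{μ•} c^λ_{μ•} ∏_i a_{μ^i}(ρ̂_i, iD) = b(λ,ϱ,D,d)`" of the proof of
Prop. 10.1, with alphabet `N = m`. [cite: IkenmeyerKandasamy2019, §10 (proof of Prop. 10.1)] -/
theorem finrank_invariants_hwPermRep_eq_bCoeff (m D d : ℕ) (ρ : Nat.Partition d)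
    (K : (i : Fin d) → Subgroup (Equiv.Perm (Fin (D * (i.1 + 1) * freq ρ (i.1 + 1)))))
    (hK : ∀ (i : Fin d) (μ : Nat.Partition (D * (i.1 + 1) * freq ρ (i.1 + 1))),
      μ.parts.card ≤ m →
        (Nat.card ↥(K i) : ℂ)⁻¹ * ∑ s : ↥(K i), spechtCharacter ℂ μ
            (s : Equiv.Perm (Fin (D * (i.1 + 1) * freq ρ (i.1 + 1)))) =
          (plethysmCoeffOfPartition ℂ m ((i.1 + 1) * D) μ : ℂ))
    (lam : Nat.Partition (∑ j : Fin d, D * (j.1 + 1) * freq ρ (j.1 + 1)))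
    (hlam : lam.parts.card ≤ m)
    (hvan : ∀ (μ : (i : Fin d) → Nat.Partition (D * (i.1 + 1) * freq ρ (i.1 + 1))) (i : Fin d),
      m < (μ i).parts.card → multiLRCoeff ℂ m μ lam = 0) :
    Module.finrank ℂ (Representation.invariants
        ((hwPermRep ℂ (D := ∑ j : Fin d, D * (j.1 + 1) * freq ρ (j.1 + 1))
            (Weight.ofPartition m lam)).comp
          ((Subgroup.pi Set.univ K).map
            ((Equiv.permCongrHom (finSigmaFinEquiv
                (n := fun j : Fin d => D * (j.1 + 1) * freq ρ (j.1 + 1)))).toMonoidHom.comp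
              (Equiv.Perm.sigmaCongrRightHom fun j : Fin d =>
                Fin (D * (j.1 + 1) * freq ρ (j.1 + 1))))).subtype)) =
      bCoeff ℂ m D d lam ρ := by
  classical
  have h := finrank_invariants_hwPermRep_map_youngEmb_pi
    (n := fun j : Fin d => D * (j.1 + 1) * freq ρ (j.1 + 1)) (N := m) K lam hlam
  apply Nat.cast_injective (R := ℂ)
  rw [bCoeff, Nat.cast_sum]
  refine h.trans (Finset.sum_congr rfl fun μ _ => ?_)
  rw [Nat.cast_mul, Nat.cast_prod]
  by_cases hμ : ∀ i, (μ i).parts.card ≤ m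
  · congr 1
    refine Finset.prod_congr rfl fun i _ => ?_
    rw [← hK i (μ i) (hμ i)]
  · push Not at hμ
    obtain ⟨i, hi⟩ := hμ
    rw [hvan μ i hi, Nat.cast_zero, zero_mul, zero_mul]

/-- **The P2 half of `IK2020_prop_10_1`, modulo the word side.** Given, for IK's blocks
`n_i = D·(i+1)·ρ̂_{i+1}`: subgroups `K_i ≤ 𝔖_{n_i}` whose block averages of Specht characters are
the plethysm coefficients `a_{μ^i}(ρ̂_{i+1}, (i+1)D)` (`ℓ(μ^i) ≤ m`), the vanishing of
`c^λ_{μ•}` for `GL_m` when some `ℓ(μ^i) > m`, and a word `w₀` of content `D·ϱ` on the positions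
`Fin (∑ n_i)` whose stabiliser up to relabelling is `ψ(∏ K_i)` — then for every `n'` with
`∑ n_i = n'` (e.g. `n' = dD`) and every `λ ⊢ n'` with `ℓ(λ) ≤ m` the hypothesis of
`IK2020_prop_10_1_of_finrank_invariants_eq_bCoeff` holds with `N = m` (the `n'`-bookkeeping is a
`subst`, no transport of words or Specht characters is needed).
[cite: IkenmeyerKandasamy2019, §10 (proof of Prop. 10.1)] -/
theorem exists_word_subgroup_finrank_eq_bCoeff (m D d : ℕ) (ρ : Nat.Partition d)
    (K : (i : Fin d) → Subgroup (Equiv.Perm (Fin (D * (i.1 + 1) * freq ρ (i.1 + 1)))))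
    (hK : ∀ (i : Fin d) (μ : Nat.Partition (D * (i.1 + 1) * freq ρ (i.1 + 1))),
      μ.parts.card ≤ m → ∀ [Fintype ↥(K i)],
        (Nat.card ↥(K i) : ℂ)⁻¹ * ∑ s : ↥(K i), spechtCharacter ℂ μ
            (s : Equiv.Perm (Fin (D * (i.1 + 1) * freq ρ (i.1 + 1)))) =
          (plethysmCoeffOfPartition ℂ m ((i.1 + 1) * D) μ : ℂ))
    (hvan : ∀ (μ : (i : Fin d) → Nat.Partition (D * (i.1 + 1) * freq ρ (i.1 + 1))) {s : ℕ}
      (lam : Nat.Partition s) (i : Fin d), m < (μ i).parts.card → multiLRCoeff ℂ m μ lam = 0)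
    (w₀ : Word m (∑ j : Fin d, D * (j.1 + 1) * freq ρ (j.1 + 1)))
    (hw₀ : wordContent w₀ = fun i : Fin m => D * ρ.sortedParts.getD (i : ℕ) 0)
    (hKw₀ : ∀ τ : Equiv.Perm (Fin (∑ j : Fin d, D * (j.1 + 1) * freq ρ (j.1 + 1))),
      (∃ σ : Equiv.Perm (Fin m), ⇑σ ∘ w₀ ∘ ⇑τ = w₀) ↔
      ∃ y : (i : Fin d) → Equiv.Perm (Fin (D * (i.1 + 1) * freq ρ (i.1 + 1))),
        (∀ i, y i ∈ K i) ∧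
          ((Equiv.permCongrHom (finSigmaFinEquiv
              (n := fun j : Fin d => D * (j.1 + 1) * freq ρ (j.1 + 1)))).toMonoidHom.comp
            (Equiv.Perm.sigmaCongrRightHom fun j : Fin d =>
              Fin (D * (j.1 + 1) * freq ρ (j.1 + 1)))) y = τ)
    (n' : ℕ) (hn' : (∑ j : Fin d, D * (j.1 + 1) * freq ρ (j.1 + 1)) = n')
    (lam : Nat.Partition n') (hlam : lam.parts.card ≤ m) :
    ∃ (w : Word m n') (K' : Subgroup (Equiv.Perm (Fin n'))) (N : ℕ),
      (wordContent w = fun i : Fin m => D * ρ.sortedParts.getD (i : ℕ) 0) ∧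
      (∀ τ, τ ∈ K' ↔ ∃ σ : Equiv.Perm (Fin m), ⇑σ ∘ w ∘ ⇑τ = w) ∧
      lam.parts.card ≤ N ∧
      Module.finrank ℂ (Representation.invariants
        ((hwPermRep ℂ (D := n') (Weight.ofPartition N lam)).comp K'.subtype)) =
        bCoeff ℂ m D d lam ρ := by
  classical
  subst hn'
  refine ⟨w₀, (Subgroup.pi Set.univ K).map
    ((Equiv.permCongrHom (finSigmaFinEquiv
        (n := fun j : Fin d => D * (j.1 + 1) * freq ρ (j.1 + 1)))).toMonoidHom.comp
      (Equiv.Perm.sigmaCongrRightHom fun j : Fin d => Fin (D * (j.1 + 1) * freq ρ (j.1 + 1)))),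
    m, hw₀, fun τ => ?_, hlam, ?_⟩
  · rw [mem_map_youngEmb_pi_iff, hKw₀]
  · exact finrank_invariants_hwPermRep_eq_bCoeff m D d ρ K (fun i μ hμ => hK i μ hμ) lam hlam
      (fun μ i hi => hvan μ lam i hi)

end IKBlocks

end YoungBranching

end Literature.Computability.AlgebraicComplexity

end
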